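import Literature.Probability.Percolation.OneArmRenewal
import Literature.Probability.Percolation.OneArmLowerBound
import HarnessLib

/-!
# The one-arm exponent from Neumann flatness alone

Topic `Probability/Percolation`; one theorem combining `oneArm_exponent_of_neumannRenewal`
(THEOREM B: uniform lower bound + Neumann flatness at subsequential limits ⇒ `oneArm_exponent`)
with the PROVED uniform lower bound `exists_lower_bound_confRad_subseqLimits` (RSW + Koebe +
portmanteau): the one remaining hypothesis is LSW's reflection/renewal condition at `θ = 2π` —
Neumann flatness of the diffusion-built renewal extension of the (twice time-averaged)
conformal-radius distribution function `w_ν(t) = ν{𝔯(K) ≤ e^{-t}}` of every subsequential weak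
limit `ν` of the hull laws (`oneArm_exponent_of_neumannFlat`). Compared with the tree's
`oneArm_exponent_of_hittingPDE` (facts `LawlerSchrammWerner2002_scalingLimit` and
`LawlerSchrammWerner2002_hittingPDE`), neither the existence of the full scaling limit nor any
regularity, PDE, Dirichlet or positivity property of the hitting function is assumed.

## References

* G. F. Lawler, O. Schramm, W. Werner, *One-arm exponent for critical 2D percolation*, Electron.
  J. Probab. 7 (2002), no. 2, Thm. 1.1, §2 (Lemma 2.2: the boundary condition at `2π`).
  [LawlerSchrammWernerEJP2002]
-/

noncomputable section

open MeasureTheory Filter Topology Set TopologicalSpace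
open Literature.Probability.LatticeModels
open Literature.Probability.RandomPlanarGeometry.RadialLoewner

namespace Literature.Probability.Percolation

/-- **The one-arm exponent from Neumann flatness at `2π`** (LSW 2002, Thm. 1.1, with the whole of
§2 except the reflection condition at `2π` derived from the radial Bessel SDE): if for every weak
limit `ν` of `lswLaw (R_k)`, `R_k → ∞`, and every `t > 0` the renewal extension
`θ ↦ renewalST 6 V (avg (avg w_ν)) θ t` has vanishing left derivative at `θ = 2π`, then
`P[0 ↔ ∂Λ_n] = n^{-5/48 + o(1)}`. [cite: LawlerSchrammWernerEJP2002, Thm. 1.1, Lemma 2.2] -/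
theorem oneArm_exponent_of_neumannFlat
    (hneu : ∀ (R : ℕ → ℝ) (ν : ProbabilityMeasure (NonemptyCompacts ℂ)),
      Tendsto R atTop atTop → Tendsto (lswLaw ∘ R) atTop (𝓝 ν) →
        ∀ t, 0 < t → HasDerivWithinAt (fun x ↦ renewalST 6 dataV
          (dataU fun s ↦ (ν : Measure (NonemptyCompacts ℂ)).real
            {K | Literature.Analysis.Complex.conformalRadius (K : Set ℂ) ≤ Real.exp (-s)}) x t)
          0 (Iic (2 * Real.pi)) (2 * Real.pi)) :
    oneArm_exponent := by
  obtain ⟨m₀, hm₀, hlow⟩ := exists_lower_bound_confRad_subseqLimits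
  refine oneArm_exponent_of_neumannRenewal hm₀ fun R ν hR hν ↦ ⟨?_, hneu R ν hR hν⟩
  have h := hlow R ν hR hν
  simpa using h

end Literature.Probability.Percolation
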